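import Summits.ResolutionOfSingularities.ResolutionOfSingularities.Theorems.FrobeniusLadderFRationalResolutionVertexChartMonoid
import HarnessLib

/-!
# Crux `FrobeniusLadder.FRationalResolution` (stmt-ResolutionOfSingularities-15317), line `redirect`,
# stub `stub_diagonalizableQuotientResolution` — **closures with vertex / free descriptions** (brick C1 of
# memo MEMO-15317-leafhand2-g7, part 1 of 2: generic lemmas for the Hirzebruch–Jung chain of the initial
# cone, `…ConeChain`)

Pure monoid combinatorics in `ℤⁿ` modulo a subgroup `L`, in the `hQ`-membership currency of
`…VertexChartMonoid`:

* `exists_cone` — the rank-two cone in normal form `L + {m u + l e : l ≥ 0, a l ≤ d m}` is a submonoid;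
* `mem_closure_iff_vertex` — if every generator of a closure has vertex coordinates for data `(v, x, c)`
  and `L, v, x, y = c v − x` lie in the closure, the closure IS the vertex chart monoid
  `L + {m v + l x : m ≥ 0, m + c l ≥ 0}`; `mem_closure_iff_free` — the same for the free description
  `L ⊕ ℕv ⊕ ℕx`; `three_coords` — non-negative combinations of `v, x, y` have vertex coordinates.

Honest label: combinatorics toward ONE leaf stub (no stub, crux or summit closed). No definitions, no named
facts, no sorry. [cite: Kato1994, (10.1)] [cite: KempfEtAl1973, Ch. I §2]
-/

-- single-problem summit: the doubled namespace component is forced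
set_option linter.dupNamespace false

open Summit.ResolutionOfSingularities.ResolutionOfSingularities.Theorems.FRationalResolution.VertexChartMonoid

namespace Summit.ResolutionOfSingularities.ResolutionOfSingularities.Theorems.FRationalResolution.ConeChainClosure

variable {n : ℕ} {L : Submodule ℤ (Fin n → ℤ)}

/-! ### Cones in normal form are submonoids -/

/-- The cone `L + {m u + l e : l ≥ 0, a l ≤ d m}` is (the carrier of) a submonoid of `ℤⁿ`. [folklore] -/
theorem exists_cone (L : Submodule ℤ (Fin n → ℤ)) (u e : Fin n → ℤ) (a d : ℕ) :
    ∃ P : AddSubmonoid (Fin n → ℤ), ∀ w, w ∈ P ↔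
      ∃ g ∈ L, ∃ m l : ℤ, 0 ≤ l ∧ (a : ℤ) * l ≤ (d : ℤ) * m ∧ w = g + m • u + l • e := by
  refine ⟨{ carrier := {w | ∃ g ∈ L, ∃ m l : ℤ, 0 ≤ l ∧ (a : ℤ) * l ≤ (d : ℤ) * m ∧ w = g + m • u + l • e}
            zero_mem' := ⟨0, L.zero_mem, 0, 0, le_rfl, by simp, by simp⟩
            add_mem' := ?_ }, fun w => Iff.rfl⟩
  rintro _ _ ⟨g₁, hg₁, m₁, l₁, hl₁, h₁, rfl⟩ ⟨g₂, hg₂, m₂, l₂, hl₂, h₂, rfl⟩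
  refine ⟨g₁ + g₂, L.add_mem hg₁ hg₂, m₁ + m₂, l₁ + l₂, by omega, ?_, by module⟩
  rw [mul_add, mul_add]; exact add_le_add h₁ h₂

/-- `0 ≤ d m` with `d > 0` forces `0 ≤ m`. [folklore] -/
theorem nonneg_of_mul_nonneg_pos {d m : ℤ} (hd : 0 < d) (h : 0 ≤ d * m) : 0 ≤ m := by
  nlinarith

/-! ### From generators to the vertex / free description of a closure -/

/-- If every generator has vertex coordinates and `L, v, x, y = c v − x` lie in the closure, the closure
IS the vertex chart monoid `L + {m v + l x : m ≥ 0, m + c l ≥ 0}`. [cite: Kato1994, (10.1)] -/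
theorem mem_closure_iff_vertex {v x : Fin n → ℤ} {c : ℕ} {T : Set (Fin n → ℤ)}
    (hT : ∀ z ∈ T, ∃ g ∈ L, ∃ m l : ℤ, 0 ≤ m ∧ 0 ≤ m + (c : ℤ) * l ∧ z = g + m • v + l • x)
    (hL : ∀ g ∈ L, g ∈ AddSubmonoid.closure T) (hv : v ∈ AddSubmonoid.closure T)
    (hx : x ∈ AddSubmonoid.closure T) (hy : (c : ℤ) • v - x ∈ AddSubmonoid.closure T)
    (w : Fin n → ℤ) :
    w ∈ AddSubmonoid.closure T ↔
      ∃ g ∈ L, ∃ m l : ℤ, 0 ≤ m ∧ 0 ≤ m + (c : ℤ) * l ∧ w = g + m • v + l • x := by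
  constructor
  · intro hw
    induction hw using AddSubmonoid.closure_induction with
    | mem z hz => exact hT z hz
    | zero => exact ⟨0, L.zero_mem, 0, 0, le_rfl, by simp, by simp⟩
    | add y z _ _ hy' hz' =>
      obtain ⟨g₁, hg₁, m₁, l₁, hm₁, hml₁, rfl⟩ := hy'
      obtain ⟨g₂, hg₂, m₂, l₂, hm₂, hml₂, rfl⟩ := hz'
      refine ⟨g₁ + g₂, L.add_mem hg₁ hg₂, m₁ + m₂, l₁ + l₂, by omega, ?_, by module⟩
      rw [mul_add]; omega
  · rintro ⟨g, hg, m, l, hm, hml, rfl⟩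
    set M := AddSubmonoid.closure T
    rcases le_or_gt 0 l with hl | hl
    · have e : g + m • v + l • x = g + m.toNat • v + l.toNat • x := by
        rw [← natCast_zsmul v, ← natCast_zsmul x, Int.toNat_of_nonneg hm, Int.toNat_of_nonneg hl]
      rw [e]
      exact M.add_mem (M.add_mem (hL g hg) (M.nsmul_mem hv _)) (M.nsmul_mem hx _)
    · have e : g + m • v + l • x =
          g + (m + (c : ℤ) * l).toNat • v + (-l).toNat • ((c : ℤ) • v - x) := by
        rw [← natCast_zsmul v, ← natCast_zsmul ((c : ℤ) • v - x), Int.toNat_of_nonneg hml,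
          Int.toNat_of_nonneg (by omega : 0 ≤ -l)]
        module
      rw [e]
      exact M.add_mem (M.add_mem (hL g hg) (M.nsmul_mem hv _)) (M.nsmul_mem hy _)

/-- If every generator has non-negative coordinates and `L, v, x` lie in the closure, the closure is the
free monoid `L ⊕ ℕv ⊕ ℕx`. [folklore] -/
theorem mem_closure_iff_free {v x : Fin n → ℤ} {T : Set (Fin n → ℤ)}
    (hT : ∀ z ∈ T, ∃ g ∈ L, ∃ m l : ℤ, 0 ≤ m ∧ 0 ≤ l ∧ z = g + m • v + l • x)
    (hL : ∀ g ∈ L, g ∈ AddSubmonoid.closure T) (hv : v ∈ AddSubmonoid.closure T)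
    (hx : x ∈ AddSubmonoid.closure T) (w : Fin n → ℤ) :
    w ∈ AddSubmonoid.closure T ↔ ∃ g ∈ L, ∃ m l : ℤ, 0 ≤ m ∧ 0 ≤ l ∧ w = g + m • v + l • x := by
  constructor
  · intro hw
    induction hw using AddSubmonoid.closure_induction with
    | mem z hz => exact hT z hz
    | zero => exact ⟨0, L.zero_mem, 0, 0, le_rfl, le_rfl, by simp⟩
    | add y z _ _ hy' hz' =>
      obtain ⟨g₁, hg₁, m₁, l₁, hm₁, hl₁, rfl⟩ := hy'
      obtain ⟨g₂, hg₂, m₂, l₂, hm₂, hl₂, rfl⟩ := hz'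
      exact ⟨g₁ + g₂, L.add_mem hg₁ hg₂, m₁ + m₂, l₁ + l₂, by omega, by omega, by module⟩
  · rintro ⟨g, hg, m, l, hm, hl, rfl⟩
    set M := AddSubmonoid.closure T
    have e : g + m • v + l • x = g + m.toNat • v + l.toNat • x := by
      rw [← natCast_zsmul v, ← natCast_zsmul x, Int.toNat_of_nonneg hm, Int.toNat_of_nonneg hl]
    rw [e]
    exact M.add_mem (M.add_mem (hL g hg) (M.nsmul_mem hv _)) (M.nsmul_mem hx _)

/-- Non-negative combinations of `v, x, y = c v − x` have vertex coordinates. [folklore] -/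
theorem three_coords (v x g : Fin n → ℤ) (c : ℕ) {α β γ : ℤ} (hα : 0 ≤ α) (hβ : 0 ≤ β) (hγ : 0 ≤ γ)
    (hg : g ∈ L) :
    ∃ g' ∈ L, ∃ m l : ℤ, 0 ≤ m ∧ 0 ≤ m + (c : ℤ) * l ∧
      g + α • v + β • x + γ • ((c : ℤ) • v - x) = g' + m • v + l • x := by
  refine ⟨g, hg, α + (c : ℤ) * γ, β - γ, by positivity, ?_, by module⟩
  have : 0 ≤ (c : ℤ) * β := by positivity
  rw [mul_sub]; linarith

end Summit.ResolutionOfSingularities.ResolutionOfSingularities.Theorems.FRationalResolution.ConeChainClosure
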